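import Literature.Analysis.FluidPDE.LerayHeatTest
import Literature.Analysis.FluidPDE.OseenHeatDuality
import Literature.Analysis.FluidPDE.KatoUniqueness
import Literature.Analysis.FluidPDE.TaoEnstrophyLocalisationProofs
import Literature.Analysis.FluidPDE.TaoQuantitativeLPTimeDeriv
import HarnessLib

/-!
# The gradient of the Oseen kernel is integrable: `‖∇ P(G_σ(·−x₀)e)‖_{L¹(ℝ³)} ≤ C σ^{-1/2} ‖e‖`

Analysis/FluidPDE support file. The Leray-projected heat kernel (Oseen tensor applied to a fixed
vector) `ψ = P(G_σ(· − x₀) e)` is the tree's divergence-free test field `lerayHeatTest x₀ σ e`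
(`LerayHeatTest.lean`, defined through its Fourier integral). Its *gradient* is integrable with the
parabolic rate `σ^{-1/2}`: this is the `|α| = 1` instance of the Oseen-tensor bounds
`|∂ₓ^α O_{j,k}(x)| ≤ C_α (1 + |x|)^{-3-|α|}`, `O_{j,k}(νt, x) = (νt)^{-3/2} O_{j,k}(x/√(νt))`
(Lemarié-Rieusset 2016, §4.5, Def. 4.2, Thm. 4.6 and Cor. 4.2; Solonnikov 1964), integrated in `x`.
The field `ψ` itself is NOT integrable (`O = O(|x|^{-3})` at infinity); its derivatives are.

Everything here is **proved**, in physical space, from the tree's Oseen–heat operator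
`𝒩_τ = e^{τΔ}P∇·` (`OseenHeat.lean`) and its `L¹ → L¹` bound
`‖(𝒩_τ F)ᵢ‖₁ ≤ 435 τ^{-1/2} Σⱼₖ ‖Fⱼₖ‖₁` (`lintegral_enorm_oseenHeat_le_of_one`):

* **identification** (`fderiv_lerayHeatTest_ae_eq_sum_oseenHeat`): for `τ > 0` and vectors `v, e`,
  `∂ᵥ P(G_{2τ}(·−x₀)e) = Σᵢ (𝒩_τ F)ᵢ bᵢ` a.e., where `F_{jk} = G_τ(·−x₀) ⟪v,bⱼ⟫⟪e,bₖ⟫` is the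
  heat-kernel tensor `(G_τ(·−x₀)v) ⊗ e` and `b` the standard orthonormal basis. Proof: both fields
  are square integrable and weakly divergence free (`isWeaklyDivFree_sum_oseenHeat_smul`;
  `IsDivFree.fderiv_apply`), and they have the same pairing `-⟪e, e^{2τΔ}(∂ᵥφ)(x₀)⟫` with every
  divergence-free test field `φ` — the Oseen side by the duality
  `integral_inner_sum_oseenHeat_tensor_eq_neg` (`OseenHeatDuality.lean`), the commutation
  `∂ᵥ e^{τΔ}φ = e^{τΔ}∂ᵥφ` and the semigroup law, the kernel side by integration by parts
  (`integral_inner_convect_add_eq_zero`) and the pairing identity `integral_inner_lerayHeatTest`;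
  two `L²_σ` fields with equal pairings against `C_{c,σ}^∞` coincide
  (`IsWeaklyDivFree.ae_eq_zero_of_memLp_of_forall_integral_inner_eq_zero`, Helmholtz annihilator);
* **the `L¹` bounds** (`lintegral_enorm_fderiv_lerayHeatTest_apply_le`,
  `lintegral_enorm_fderiv_lerayHeatTest_le`):
  `∫ ‖∂ᵥ P(G_σ(·−x₀)e)‖ ≤ 23490 σ^{-1/2} ‖v‖‖e‖`, `∫ ‖D P(G_σ(·−x₀)e)‖ ≤ 70470 σ^{-1/2} ‖e‖`
  (numerical constants inherited from `OseenHeat.lean`, not optimised);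
* **the convective pairing bound** (`enorm_integral_inner_convect_lerayHeatTest_le_of_bound`,
  `exists_convect_lerayHeatTest_bound`): for ANY field `a` with `|a| ≤ M` pointwise,
  `|∫ ⟪a, (a·∇) P(G_{ε+s}(·−x₀)e)⟫| ≤ 70470 s^{-1/2} M² ‖e‖` — the linear estimate behind Leray's
  short-time sup bound with force (Tao 2013, proof of Prop. 9.1, (9.2), tested form).

WHAT THIS IS NOT: not a statement about Navier–Stokes solutions — a linear harmonic-analysis
estimate for the Stokes semigroup kernel.

## Mathlib / tree search

Tree (reused, not restated): `lerayHeatTest`, `contDiff_lerayHeatTest`, `fderiv_lerayHeatTest_apply`,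
`isDivFree_lerayHeatTest`, `integral_inner_lerayHeatTest` (`LerayHeatTest.lean`); `oseenHeat`,
`lintegral_enorm_oseenHeat_le_of_one` (`OseenHeat.lean`); `memLp_oseenHeat` (`OseenHeatLpBounds.lean`);
`isWeaklyDivFree_sum_oseenHeat_smul` (`OseenHeatWeakDiv.lean`); `integral_inner_sum_oseenHeat_tensor_eq_neg`
(`OseenHeatDuality.lean`); `IsWeaklyDivFree.ae_eq_zero_of_memLp_of_forall_integral_inner_eq_zero`
(`HelmholtzAnnihilator.lean`); `IsWeaklyDivFree.sub` (`KatoUniqueness.lean`); `IsDivFree.fderiv_apply`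
(`TaoEnstrophyLocalisationProofs.lean`); `integral_inner_convect_add_eq_zero` (`WholeSpaceIBP.lean`);
`heatExtension_add_holds`, `lintegral_enorm_heatKernel`, `fderiv_heatExtension_apply_of_hasCompactSupport`,
`heatExtension_eq_integral_sub` (`UnboundedOperators/HeatKernel*`). `lean search 'oseenKernel|lintegral.*fderiv_lerayHeatTest' --decl`:
only the `L²` statement `lintegral_frobeniusNormSq_fderiv_lerayHeatTest_lt_top` — no `L¹` bound before this file.
`opNorm_le_sum_norm_apply_orthonormalBasis` (`TaoQuantitativeLPTimeDeriv.lean`); the Fourier-majorant twin of the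
convective bound is `enorm_integral_inner_convect_lerayHeatTest_le` (`TaoDuhamelSpeedPointwise.lean`, rate `s^{-2}‖a‖₂²`).
Mathlib: `finrank_euclideanSpace_fin`, `integral_inner`, `enorm_integral_le_lintegral_enorm`,
`Real.rpow_le_rpow_of_nonpos`.

## References

* P. G. Lemarié-Rieusset, *The Navier–Stokes Problem in the 21st Century*, CRC Press 2016,
  doi:10.1201/b19556, §4.5: Def. 4.2 (Oseen tensor), Thm. 4.6 (Oseen's formula (4.12)), Cor. 4.2
  (`|∂ₓ^α O_{j,k}(x)| ≤ C_α(1+|x|)^{-3-|α|}`), PDF p. 81. [`LemarieRieusset2016`]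
* T. Tao, *Localisation and compactness properties of the Navier–Stokes global regularity problem*,
  Anal. PDE 6 (2013) = arXiv:1108.1165, §9, proof of Prop. 9.1. [`Tao2011`]
-/

noncomputable section

open MeasureTheory Set Function Filter Topology InnerProductSpace
open scoped ENNReal NNReal RealInnerProductSpace FourierTransform

namespace Literature.Analysis.FluidPDE

open UnboundedOperators

/-! ## Generic helpers -/

section Helpers

variable {E : Type*} [NormedAddCommGroup E] [InnerProductSpace ℝ E]
variable {F : Type*} [NormedAddCommGroup F] [NormedSpace ℝ F]

/-- `‖⟪a, L a⟫‖ ≤ M² ‖L‖` when `‖a‖ ≤ M`. [folklore] -/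
private theorem norm_inner_apply_self_le {a : E} {M : ℝ} (ha : ‖a‖ ≤ M) (L : E →L[ℝ] E) :
    ‖⟪a, L a⟫‖ ≤ M ^ 2 * ‖L‖ := by
  calc ‖⟪a, L a⟫‖ ≤ ‖a‖ * ‖L a‖ := norm_inner_le_norm _ _
    _ ≤ ‖a‖ * (‖L‖ * ‖a‖) := mul_le_mul_of_nonneg_left (L.le_opNorm a) (norm_nonneg _)
    _ = ‖a‖ ^ 2 * ‖L‖ := by ring
    _ ≤ M ^ 2 * ‖L‖ := mul_le_mul_of_nonneg_right (pow_le_pow_left₀ (norm_nonneg _) ha 2) (norm_nonneg _)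

/-- `x ↦ g(x) • c` is in `L^p` when the scalar function `g` is. [folklore] -/
private theorem memLp_smul_const_of_memLp {X : Type*} [MeasurableSpace X] {μ : Measure X} {p : ℝ≥0∞}
    {g : X → ℝ} (hg : MemLp g p μ) (c : F) : MemLp (fun x => g x • c) p μ :=
  hg.of_le_mul (c := ‖c‖) (hg.1.smul_const c) (Eventually.of_forall fun x => by
    rw [norm_smul, mul_comm])

end Helpers

/-! ## The heat-kernel tensor `(G_τ(·−x₀) v) ⊗ e` and its Oseen–heat field -/

section Tensor

variable {x₀ e v : EuclideanSpace ℝ (Fin 3)} {τ : ℝ}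

/-- `dim ℝ³ = 3` in the exact form the Oseen–heat lemmas take it (local copy of the tree's
`finrank_euclideanSpace_fin_three`, `NSSuitableESS.lean`, to keep the imports small). [folklore] -/
private theorem finrank_E3 : Module.finrank ℝ (EuclideanSpace ℝ (Fin 3)) = 3 :=
  finrank_euclideanSpace_fin

/-- The translated heat kernel `y ↦ G_τ(y − x₀)` is in every `L^q`, `1 ≤ q`. [folklore] -/
private theorem memLp_heatKernel_sub_const (hτ : 0 < τ) {q : ℝ≥0∞} (hq : 1 ≤ q) (x₀ : EuclideanSpace ℝ (Fin 3)) :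
    MemLp (fun y : EuclideanSpace ℝ (Fin 3) => heatKernel τ (y - x₀)) q volume :=
  (memLp_heatKernel (E := EuclideanSpace ℝ (Fin 3)) hτ hq).comp_measurePreserving
    (measurePreserving_sub_right volume x₀)

/-- The entries of the heat-kernel tensor, `F_{jk}(y) = ⟪G_τ(y−x₀) v, bⱼ⟫⟪e, bₖ⟫ = G_τ(y−x₀) (⟪v,bⱼ⟫⟪e,bₖ⟫)`.
[folklore] -/
private theorem heatKernelTensor_apply (y : EuclideanSpace ℝ (Fin 3)) (j k : Fin (Module.finrank ℝ (EuclideanSpace ℝ (Fin 3)))) :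
    ⟪heatKernel τ (y - x₀) • v, stdOrthonormalBasis ℝ (EuclideanSpace ℝ (Fin 3)) j⟫ *
        ⟪e, stdOrthonormalBasis ℝ (EuclideanSpace ℝ (Fin 3)) k⟫ =
      (⟪v, stdOrthonormalBasis ℝ (EuclideanSpace ℝ (Fin 3)) j⟫ *
        ⟪e, stdOrthonormalBasis ℝ (EuclideanSpace ℝ (Fin 3)) k⟫) * heatKernel τ (y - x₀) := by
  rw [real_inner_smul_left]
  ring

/-- The entries of the heat-kernel tensor are in every `L^q`, `1 ≤ q`. [folklore] -/
private theorem memLp_heatKernelTensor (hτ : 0 < τ) {q : ℝ≥0∞} (hq : 1 ≤ q)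
    (j k : Fin (Module.finrank ℝ (EuclideanSpace ℝ (Fin 3)))) :
    MemLp (fun y : EuclideanSpace ℝ (Fin 3) =>
      ⟪heatKernel τ (y - x₀) • v, stdOrthonormalBasis ℝ (EuclideanSpace ℝ (Fin 3)) j⟫ *
        ⟪e, stdOrthonormalBasis ℝ (EuclideanSpace ℝ (Fin 3)) k⟫) q volume := by
  simp_rw [heatKernelTensor_apply]
  exact (memLp_heatKernel_sub_const hτ hq x₀).const_mul _

/-- `‖F_{jk}‖₁ ≤ ‖v‖ ‖e‖` (`‖G_τ‖₁ = 1`). [folklore] -/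
private theorem eLpNorm_one_heatKernelTensor_le (hτ : 0 < τ)
    (j k : Fin (Module.finrank ℝ (EuclideanSpace ℝ (Fin 3)))) :
    eLpNorm (fun y : EuclideanSpace ℝ (Fin 3) =>
      ⟪heatKernel τ (y - x₀) • v, stdOrthonormalBasis ℝ (EuclideanSpace ℝ (Fin 3)) j⟫ *
        ⟪e, stdOrthonormalBasis ℝ (EuclideanSpace ℝ (Fin 3)) k⟫) 1 volume ≤ ‖v‖ₑ * ‖e‖ₑ := by
  simp_rw [heatKernelTensor_apply]
  rw [show (fun y : EuclideanSpace ℝ (Fin 3) =>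
      ⟪v, stdOrthonormalBasis ℝ (EuclideanSpace ℝ (Fin 3)) j⟫ *
        ⟪e, stdOrthonormalBasis ℝ (EuclideanSpace ℝ (Fin 3)) k⟫ * heatKernel τ (y - x₀)) =
      (⟪v, stdOrthonormalBasis ℝ (EuclideanSpace ℝ (Fin 3)) j⟫ *
        ⟪e, stdOrthonormalBasis ℝ (EuclideanSpace ℝ (Fin 3)) k⟫) •
      (fun y : EuclideanSpace ℝ (Fin 3) => heatKernel τ (y - x₀)) from
      funext fun y => by simp only [Pi.smul_apply, smul_eq_mul],
    eLpNorm_const_smul, eLpNorm_one_eq_lintegral_enorm,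
    lintegral_sub_right_eq_self (fun y => ‖heatKernel τ y‖ₑ) x₀,
    lintegral_enorm_heatKernel hτ, mul_one, enorm_mul]
  gcongr
  · rw [← ofReal_norm, ← ofReal_norm]
    refine ENNReal.ofReal_le_ofReal ?_
    calc ‖⟪v, stdOrthonormalBasis ℝ (EuclideanSpace ℝ (Fin 3)) j⟫‖
        ≤ ‖v‖ * ‖stdOrthonormalBasis ℝ (EuclideanSpace ℝ (Fin 3)) j‖ := norm_inner_le_norm _ _
      _ = ‖v‖ := by rw [(stdOrthonormalBasis ℝ (EuclideanSpace ℝ (Fin 3))).orthonormal.1 j, mul_one]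
  · rw [← ofReal_norm, ← ofReal_norm]
    refine ENNReal.ofReal_le_ofReal ?_
    calc ‖⟪e, stdOrthonormalBasis ℝ (EuclideanSpace ℝ (Fin 3)) k⟫‖
        ≤ ‖e‖ * ‖stdOrthonormalBasis ℝ (EuclideanSpace ℝ (Fin 3)) k‖ := norm_inner_le_norm _ _
      _ = ‖e‖ := by rw [(stdOrthonormalBasis ℝ (EuclideanSpace ℝ (Fin 3))).orthonormal.1 k, mul_one]

/-- `Σⱼₖ ‖F_{jk}‖₁ ≤ 9 ‖v‖ ‖e‖`. [folklore] -/
private theorem sum_eLpNorm_one_heatKernelTensor_le (hτ : 0 < τ) :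
    ∑ j, ∑ k, eLpNorm (fun y : EuclideanSpace ℝ (Fin 3) =>
      ⟪heatKernel τ (y - x₀) • v, stdOrthonormalBasis ℝ (EuclideanSpace ℝ (Fin 3)) j⟫ *
        ⟪e, stdOrthonormalBasis ℝ (EuclideanSpace ℝ (Fin 3)) k⟫) 1 volume ≤ 9 * (‖v‖ₑ * ‖e‖ₑ) := by
  calc ∑ j, ∑ k, eLpNorm (fun y : EuclideanSpace ℝ (Fin 3) =>
      ⟪heatKernel τ (y - x₀) • v, stdOrthonormalBasis ℝ (EuclideanSpace ℝ (Fin 3)) j⟫ *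
        ⟪e, stdOrthonormalBasis ℝ (EuclideanSpace ℝ (Fin 3)) k⟫) 1 volume
      ≤ ∑ _j : Fin (Module.finrank ℝ (EuclideanSpace ℝ (Fin 3))),
          ∑ _k : Fin (Module.finrank ℝ (EuclideanSpace ℝ (Fin 3))), ‖v‖ₑ * ‖e‖ₑ :=
        Finset.sum_le_sum fun j _ => Finset.sum_le_sum fun k _ => eLpNorm_one_heatKernelTensor_le hτ j k
    _ = 9 * (‖v‖ₑ * ‖e‖ₑ) := by
        rw [Finset.sum_const, Finset.sum_const, Finset.card_univ, Fintype.card_fin,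
          finrank_E3, nsmul_eq_mul, nsmul_eq_mul]
        push_cast
        ring

/-- The Oseen–heat field of the heat-kernel tensor, `W = Σᵢ (𝒩_τ F)ᵢ bᵢ`, is square integrable.
[folklore] -/
private theorem memLp_two_sum_oseenHeat_heatKernelTensor (hτ : 0 < τ) :
    MemLp (fun x : EuclideanSpace ℝ (Fin 3) => ∑ i, oseenHeat τ (fun j k y =>
      ⟪heatKernel τ (y - x₀) • v, stdOrthonormalBasis ℝ (EuclideanSpace ℝ (Fin 3)) j⟫ *
        ⟪e, stdOrthonormalBasis ℝ (EuclideanSpace ℝ (Fin 3)) k⟫) i x •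
          stdOrthonormalBasis ℝ (EuclideanSpace ℝ (Fin 3)) i) 2 volume :=
by
  have hF2 : ∀ j k, MemLp (fun y : EuclideanSpace ℝ (Fin 3) =>
      ⟪heatKernel τ (y - x₀) • v, stdOrthonormalBasis ℝ (EuclideanSpace ℝ (Fin 3)) j⟫ *
        ⟪e, stdOrthonormalBasis ℝ (EuclideanSpace ℝ (Fin 3)) k⟫) 2 volume := fun j k =>
    memLp_heatKernelTensor hτ one_le_two j k
  have hN : ∀ i, MemLp (oseenHeat τ (fun j k y =>
      ⟪heatKernel τ (y - x₀) • v, stdOrthonormalBasis ℝ (EuclideanSpace ℝ (Fin 3)) j⟫ *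
        ⟪e, stdOrthonormalBasis ℝ (EuclideanSpace ℝ (Fin 3)) k⟫) i) 2 volume := fun i =>
    memLp_oseenHeat finrank_E3 (p := 2) (q := 2) one_le_two le_rfl hF2 hτ i
  have hS : ∀ i, MemLp (fun x : EuclideanSpace ℝ (Fin 3) => oseenHeat τ (fun j k y =>
      ⟪heatKernel τ (y - x₀) • v, stdOrthonormalBasis ℝ (EuclideanSpace ℝ (Fin 3)) j⟫ *
        ⟪e, stdOrthonormalBasis ℝ (EuclideanSpace ℝ (Fin 3)) k⟫) i x •
          stdOrthonormalBasis ℝ (EuclideanSpace ℝ (Fin 3)) i) 2 volume := fun i =>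
    memLp_smul_const_of_memLp (hN i) _
  exact memLp_finsetSum Finset.univ fun i _ => hS i

/-- The Oseen–heat field of the heat-kernel tensor is weakly divergence free. [folklore] -/
private theorem isWeaklyDivFree_sum_oseenHeat_heatKernelTensor (hτ : 0 < τ) :
    IsWeaklyDivFree (fun x : EuclideanSpace ℝ (Fin 3) => ∑ i, oseenHeat τ (fun j k y =>
      ⟪heatKernel τ (y - x₀) • v, stdOrthonormalBasis ℝ (EuclideanSpace ℝ (Fin 3)) j⟫ *
        ⟪e, stdOrthonormalBasis ℝ (EuclideanSpace ℝ (Fin 3)) k⟫) i x •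
          stdOrthonormalBasis ℝ (EuclideanSpace ℝ (Fin 3)) i) :=
  isWeaklyDivFree_sum_oseenHeat_smul finrank_E3
    (fun j k => memLp_heatKernelTensor (x₀ := x₀) (e := e) (v := v) hτ le_top j k) hτ

end Tensor

/-! ## Pairings against divergence-free test fields -/

section Pairing

variable {x₀ e v : EuclideanSpace ℝ (Fin 3)} {τ σ : ℝ}

/-- The directional derivative `z ↦ Dφ(z) v` of a test field is in every `L^p`. [folklore] -/
private theorem memLp_fderiv_apply_of_isTestFunctionOn {φ : EuclideanSpace ℝ (Fin 3) → EuclideanSpace ℝ (Fin 3)}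
    (hφ : FunctionSpaces.IsTestFunctionOn (⊤ : TopologicalSpace.Opens (EuclideanSpace ℝ (Fin 3))) φ)
    (v : EuclideanSpace ℝ (Fin 3)) (p : ℝ≥0∞) :
    MemLp (fun z => fderiv ℝ φ z v) p volume :=
  ((hφ.contDiff.continuous_fderiv (by simp)).clm_apply continuous_const).memLp_of_hasCompactSupport
    (hφ.hasCompactSupport.fderiv_apply (𝕜 := ℝ) v)

/-- The directional derivative of a test field is `C¹`. [folklore] -/
private theorem contDiff_one_fderiv_apply_of_isTestFunctionOn {φ : EuclideanSpace ℝ (Fin 3) → EuclideanSpace ℝ (Fin 3)}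
    (hφ : FunctionSpaces.IsTestFunctionOn (⊤ : TopologicalSpace.Opens (EuclideanSpace ℝ (Fin 3))) φ)
    (v : EuclideanSpace ℝ (Fin 3)) : ContDiff ℝ 1 (fun z => fderiv ℝ φ z v) :=
  (hφ.contDiff.fderiv_right (m := 1) (by norm_cast)).clm_apply contDiff_const

/-- The directional derivative of a divergence-free test field is weakly divergence free
(`div ∂ᵥφ = ∂ᵥ div φ = 0`). [folklore] -/
private theorem isWeaklyDivFree_fderiv_apply_of_isTestFunctionOn
    {φ : EuclideanSpace ℝ (Fin 3) → EuclideanSpace ℝ (Fin 3)}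
    (hφ : FunctionSpaces.IsTestFunctionOn (⊤ : TopologicalSpace.Opens (EuclideanSpace ℝ (Fin 3))) φ)
    (hdiv : VectorCalculus.IsDivFree φ) (v : EuclideanSpace ℝ (Fin 3)) :
    IsWeaklyDivFree (fun z => fderiv ℝ φ z v) :=
  VectorCalculus.IsDivFree.isWeaklyDivFree_holds
    (VectorCalculus.IsDivFree.fderiv_apply (hφ.contDiff.of_le (by norm_cast)) hdiv v)
    (contDiff_one_fderiv_apply_of_isTestFunctionOn hφ v)

/-- **The Oseen–heat field of the heat-kernel tensor tested against a divergence-free field**: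
`∫ ⟪Σᵢ (𝒩_τ((G_τ(·−x₀)v) ⊗ e))ᵢ bᵢ, φ⟫ = -⟪e, (e^{2τΔ} ∂ᵥφ)(x₀)⟫` (duality
`⟨e^{τΔ}P∇·F, φ⟩ = -⟨F, ∇e^{τΔ}φ⟩`, `∂ᵥe^{τΔ}φ = e^{τΔ}∂ᵥφ`, and the semigroup law against the
kernel `G_τ(·−x₀)`). [cite: LemarieRieusset2016, Thm. 6.1 ((6.12) ⇒ (6.11)) and §4.5 Def. 4.2] -/
theorem integral_inner_sum_oseenHeat_heatKernelTensor_eq (hτ : 0 < τ)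
    {φ : EuclideanSpace ℝ (Fin 3) → EuclideanSpace ℝ (Fin 3)}
    (hφ : FunctionSpaces.IsTestFunctionOn (⊤ : TopologicalSpace.Opens (EuclideanSpace ℝ (Fin 3))) φ)
    (hdiv : VectorCalculus.IsDivFree φ) :
    ∫ x, ⟪∑ i, oseenHeat τ (fun j k y =>
      ⟪heatKernel τ (y - x₀) • v, stdOrthonormalBasis ℝ (EuclideanSpace ℝ (Fin 3)) j⟫ *
        ⟪e, stdOrthonormalBasis ℝ (EuclideanSpace ℝ (Fin 3)) k⟫) i x •
          stdOrthonormalBasis ℝ (EuclideanSpace ℝ (Fin 3)) i, φ x⟫ =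
      -⟪e, heatExtension (fun z => fderiv ℝ φ z v) (τ + τ) x₀⟫ := by
  have hφ1 : ContDiff ℝ 1 φ := hφ.contDiff.of_le (by exact_mod_cast le_top)
  have hφ2 : MemLp φ 2 volume :=
    hφ.contDiff.continuous.memLp_of_hasCompactSupport hφ.hasCompactSupport
  have hF2 : ∀ j k, MemLp (fun y : EuclideanSpace ℝ (Fin 3) =>
      ⟪heatKernel τ (y - x₀) • v, stdOrthonormalBasis ℝ (EuclideanSpace ℝ (Fin 3)) j⟫ *
        ⟪e, stdOrthonormalBasis ℝ (EuclideanSpace ℝ (Fin 3)) k⟫) 2 volume := fun j k =>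
    memLp_heatKernelTensor hτ one_le_two j k
  have hN : ∀ i, MemLp (oseenHeat τ (fun j k y =>
      ⟪heatKernel τ (y - x₀) • v, stdOrthonormalBasis ℝ (EuclideanSpace ℝ (Fin 3)) j⟫ *
        ⟪e, stdOrthonormalBasis ℝ (EuclideanSpace ℝ (Fin 3)) k⟫) i) 2 volume := fun i =>
    memLp_oseenHeat finrank_E3 (p := 2) (q := 2) one_le_two le_rfl hF2 hτ i
  have hint : ∀ i, Integrable (fun x => oseenHeat τ (fun j k y =>
      ⟪heatKernel τ (y - x₀) • v, stdOrthonormalBasis ℝ (EuclideanSpace ℝ (Fin 3)) j⟫ *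
        ⟪e, stdOrthonormalBasis ℝ (EuclideanSpace ℝ (Fin 3)) k⟫) i x *
          ⟪φ x, stdOrthonormalBasis ℝ (EuclideanSpace ℝ (Fin 3)) i⟫) volume := fun i => by
    have h := MemLp.mul' (r := 1) (hφ2.inner_const (stdOrthonormalBasis ℝ (EuclideanSpace ℝ (Fin 3)) i))
      (hN i)
    rwa [memLp_one_iff_integrable] at h
  have h := integral_inner_sum_oseenHeat_tensor_eq_neg finrank_E3 (p := 2) (q := 2)
    (u := fun y => heatKernel τ (y - x₀) • v) (v := fun _ => e) hF2 hτ hφ hdiv hint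
  rw [h]
  congr 1
  -- `D(e^{τΔ}φ)(y)(G_τ(y−x₀) v) = G_τ(y−x₀) • e^{τΔ}(∂ᵥφ)(y)`
  have hcomm : ∀ y : EuclideanSpace ℝ (Fin 3),
      fderiv ℝ (heatExtension φ τ) y (heatKernel τ (y - x₀) • v) =
        heatKernel τ (y - x₀) • heatExtension (fun z => fderiv ℝ φ z v) τ y := fun y => by
    rw [map_smul, fderiv_heatExtension_apply_of_hasCompactSupport hφ1 hφ.hasCompactSupport τ y v]
  simp_rw [hcomm]
  -- the semigroup law against the kernel
  have hg : MemLp (fun z => fderiv ℝ φ z v) ⊤ volume := memLp_fderiv_apply_of_isTestFunctionOn hφ v ⊤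
  have hKi : Integrable (fun y : EuclideanSpace ℝ (Fin 3) =>
      heatKernel τ (y - x₀) • heatExtension (fun z => fderiv ℝ φ z v) τ y) :=
    ((integrable_heatKernel_holds hτ).comp_sub_right x₀).smul_of_top_left
      (memLp_heatExtension_holds hg le_top hτ)
  rw [integral_inner hKi e]
  congr 1
  rw [← heatExtension_add_holds hg le_top hτ hτ, heatExtension_eq_integral_sub]
  refine integral_congr_ae (Eventually.of_forall fun y => ?_)
  dsimp only
  rw [← heatKernel_neg, neg_sub]

/-- **The derivative of the Leray-projected heat kernel tested against a divergence-free field**: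
`∫ ⟪∂ᵥ P(G_σ(·−x₀)e), φ⟫ = -⟪e, (e^{σΔ} ∂ᵥφ)(x₀)⟫` (integration by parts and the pairing
identity `∫⟪w, P(G_σ(·−x₀)e)⟫ = ⟪e^{σΔ}w(x₀), e⟫` for the divergence-free `w = ∂ᵥφ`).
[cite: LemarieRieusset2016, §4.5 Def. 4.2 (the Oseen tensor `W_{νt} ∗ ℙ`)] -/
theorem integral_inner_fderiv_lerayHeatTest_eq (hσ : 0 < σ) (v : EuclideanSpace ℝ (Fin 3))
    {φ : EuclideanSpace ℝ (Fin 3) → EuclideanSpace ℝ (Fin 3)}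
    (hφ : FunctionSpaces.IsTestFunctionOn (⊤ : TopologicalSpace.Opens (EuclideanSpace ℝ (Fin 3))) φ)
    (hdiv : VectorCalculus.IsDivFree φ) :
    ∫ x, ⟪fderiv ℝ (lerayHeatTest x₀ σ e) x v, φ x⟫ =
      -⟪e, heatExtension (fun z => fderiv ℝ φ z v) σ x₀⟫ := by
  have hψ1 : ContDiff ℝ 1 (lerayHeatTest x₀ σ e) := (contDiff_lerayHeatTest hσ).of_le (by simp)
  have hφ1 : ContDiff ℝ 1 φ := hφ.contDiff.of_le (by exact_mod_cast le_top)
  have h := integral_inner_convect_add_eq_zero (u := fun _ : EuclideanSpace ℝ (Fin 3) => v)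
    (v := lerayHeatTest x₀ σ e) (w := φ) contDiff_const hψ1 hφ1 hφ.hasCompactSupport
  have hdiv0 : ∀ x : EuclideanSpace ℝ (Fin 3),
      VectorCalculus.divergence (fun _ : EuclideanSpace ℝ (Fin 3) => v) x = 0 := fun x => by
    simp [VectorCalculus.divergence]
  simp only [convect_apply, hdiv0, zero_mul, integral_zero, add_zero] at h
  have h2 : ∫ x, ⟪lerayHeatTest x₀ σ e x, fderiv ℝ φ x v⟫ =
      ⟪heatExtension (fun z => fderiv ℝ φ z v) σ x₀, e⟫ := by
    rw [← integral_inner_lerayHeatTest hσ (memLp_fderiv_apply_of_isTestFunctionOn hφ v 2)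
      (isWeaklyDivFree_fderiv_apply_of_isTestFunctionOn hφ hdiv v)]
    exact integral_congr_ae (Eventually.of_forall fun x => real_inner_comm _ _)
  rw [h2, real_inner_comm] at h
  linarith

end Pairing

/-! ## Identification and the `L¹` bounds -/

section L1

variable {x₀ e : EuclideanSpace ℝ (Fin 3)} {τ σ : ℝ}

/-- The directional derivative `x ↦ D P(G_σ(·−x₀)e)(x) v` is square integrable
(`|∂ₓO_{j,k}(t,x)| ≤ C t^{-2}(1+|x|/√t)^{-4} ∈ L²`; here from Plancherel on the derivative symbols).
[cite: LemarieRieusset2016, §4.5 Cor. 4.2 (|∂ₓ^α O_{j,k}(x)| ≤ C_α(1+|x|)^{-3-|α|})] -/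
theorem memLp_two_fderiv_lerayHeatTest_apply (hσ : 0 < σ) (x₀ e v : EuclideanSpace ℝ (Fin 3)) :
    MemLp (fun x => fderiv ℝ (lerayHeatTest x₀ σ e) x v) 2 volume := by
  have h : (fun x => fderiv ℝ (lerayHeatTest x₀ σ e) x v) =
      famVec fun j x => (𝓕 (lerayHeatDerivSymbol x₀ σ e v j) x).re := by
    funext x
    ext j
    rw [fderiv_lerayHeatTest_apply hσ, famVec_apply]
  rw [h]
  exact memLp_two_famVec
    (fun j => Complex.continuous_re.comp (continuous_fourier_of_integrable
      (integrable_lerayHeatDerivSymbol hσ v j)))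
    (fun j => memLp_two_re_fourier (integrable_lerayHeatDerivSymbol hσ v j)
      (memLp_two_lerayHeatDerivSymbol hσ v j))

/-- **Identification (physical-space representation of the Oseen kernel's gradient).** For
`τ > 0` and vectors `v, e`, the directional derivative `∂ᵥ P(G_{2τ}(·−x₀)e)` coincides a.e. with
the Oseen–heat field `Σᵢ (𝒩_τ F)ᵢ bᵢ` of the heat-kernel tensor `F = (G_τ(·−x₀)v) ⊗ e`
(`(𝒩_τF)ᵢ = Σⱼ ∂ⱼe^{τΔ}Fⱼᵢ + Σⱼₖ ∫₀^∞ ∂ᵢ∂ⱼ∂ₖ e^{(τ+s)Δ}Fⱼₖ ds`, i.e. Lemarié-Rieusset's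
`O_{j,k}(t) = δ_{j,k}W_t + G ∗ ∂ⱼ∂ₖW_t` with `G ∗ W_t = ∫_t^∞ W_u du`, differentiated once): both
are `L²_σ` fields with the same pairing against every divergence-free test field.
[cite: LemarieRieusset2016, §4.5 Def. 4.2, Thm. 4.6 (proof: `G ∗ W = ∫₁^∞ W_u du`)] -/
theorem fderiv_lerayHeatTest_ae_eq_sum_oseenHeat (hτ : 0 < τ) (x₀ e v : EuclideanSpace ℝ (Fin 3)) :
    (fun x => fderiv ℝ (lerayHeatTest x₀ (τ + τ) e) x v) =ᵐ[volume]
      fun x => ∑ i, oseenHeat τ (fun j k y =>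
        ⟪heatKernel τ (y - x₀) • v, stdOrthonormalBasis ℝ (EuclideanSpace ℝ (Fin 3)) j⟫ *
          ⟪e, stdOrthonormalBasis ℝ (EuclideanSpace ℝ (Fin 3)) k⟫) i x •
            stdOrthonormalBasis ℝ (EuclideanSpace ℝ (Fin 3)) i := by
  have hσ : 0 < τ + τ := add_pos hτ hτ
  have hD2 := memLp_two_fderiv_lerayHeatTest_apply hσ x₀ e v
  have hDdiv : IsWeaklyDivFree (fun x => fderiv ℝ (lerayHeatTest x₀ (τ + τ) e) x v) :=
    VectorCalculus.IsDivFree.isWeaklyDivFree_holds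
      (VectorCalculus.IsDivFree.fderiv_apply ((contDiff_lerayHeatTest hσ).of_le (by norm_cast))
        (isDivFree_lerayHeatTest hσ) v)
      (((contDiff_lerayHeatTest hσ).fderiv_right (m := 1) (by norm_cast)).clm_apply
        contDiff_const)
  have hW2 := memLp_two_sum_oseenHeat_heatKernelTensor (x₀ := x₀) (e := e) (v := v) hτ
  have hWdiv := isWeaklyDivFree_sum_oseenHeat_heatKernelTensor (x₀ := x₀) (e := e) (v := v) hτ
  have hzero := IsWeaklyDivFree.ae_eq_zero_of_memLp_of_forall_integral_inner_eq_zero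
    ENNReal.one_lt_two ENNReal.ofNat_lt_top (hW2.sub hD2) (hWdiv.sub one_le_two hDdiv hW2 hD2)
    (fun φ hφ hdiv => by
      have hφ2 : MemLp φ 2 volume :=
        hφ.contDiff.continuous.memLp_of_hasCompactSupport hφ.hasCompactSupport
      have iW := FunctionSpaces.integrable_inner_of_eLpNorm_two_lt_top hW2.1 hφ2.1 hW2.2 hφ2.2
      have iD := FunctionSpaces.integrable_inner_of_eLpNorm_two_lt_top hD2.1 hφ2.1 hD2.2 hφ2.2
      simp only [Pi.sub_apply, inner_sub_left]
      rw [integral_sub iW iD, integral_inner_sum_oseenHeat_heatKernelTensor_eq hτ hφ hdiv,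
        integral_inner_fderiv_lerayHeatTest_eq hσ v hφ hdiv, sub_self])
  filter_upwards [hzero] with x hx
  rw [Pi.sub_apply, Pi.zero_apply, sub_eq_zero] at hx
  exact hx.symm

/-- `‖bᵢ‖ₑ = 1` for the standard orthonormal basis. [folklore] -/
private theorem enorm_stdOrthonormalBasis (i : Fin (Module.finrank ℝ (EuclideanSpace ℝ (Fin 3)))) :
    ‖stdOrthonormalBasis ℝ (EuclideanSpace ℝ (Fin 3)) i‖ₑ = 1 := by
  rw [← ofReal_norm, (stdOrthonormalBasis ℝ (EuclideanSpace ℝ (Fin 3))).orthonormal.1 i,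
    ENNReal.ofReal_one]

/-- The `L¹` bound at the doubled clock: `∫ ‖∂ᵥ P(G_{2τ}(·−x₀)e)‖ ≤ 11745 τ^{-1/2} ‖v‖‖e‖`
(`3 · 435 · 9`). [cite: LemarieRieusset2016, §4.5 Cor. 4.2 (|∂ₓO_{j,k}(x)| ≤ C(1+|x|)^{-4}) with the scaling after Def. 4.2] -/
theorem lintegral_enorm_fderiv_lerayHeatTest_apply_le_of_add_self (hτ : 0 < τ)
    (x₀ e v : EuclideanSpace ℝ (Fin 3)) :
    ∫⁻ x, ‖fderiv ℝ (lerayHeatTest x₀ (τ + τ) e) x v‖ₑ ≤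
      ENNReal.ofReal (11745 * τ ^ (-(1 / 2 : ℝ))) * (‖v‖ₑ * ‖e‖ₑ) := by
  have hcongr : ∫⁻ x, ‖fderiv ℝ (lerayHeatTest x₀ (τ + τ) e) x v‖ₑ =
      ∫⁻ x, ‖∑ i, oseenHeat τ (fun j k y =>
        ⟪heatKernel τ (y - x₀) • v, stdOrthonormalBasis ℝ (EuclideanSpace ℝ (Fin 3)) j⟫ *
          ⟪e, stdOrthonormalBasis ℝ (EuclideanSpace ℝ (Fin 3)) k⟫) i x •
            stdOrthonormalBasis ℝ (EuclideanSpace ℝ (Fin 3)) i‖ₑ :=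
    lintegral_congr_ae (by
      filter_upwards [fderiv_lerayHeatTest_ae_eq_sum_oseenHeat hτ x₀ e v] with x hx
      rw [hx])
  rw [hcongr]
  have hF1 : ∀ j k, MemLp (fun y : EuclideanSpace ℝ (Fin 3) =>
      ⟪heatKernel τ (y - x₀) • v, stdOrthonormalBasis ℝ (EuclideanSpace ℝ (Fin 3)) j⟫ *
        ⟪e, stdOrthonormalBasis ℝ (EuclideanSpace ℝ (Fin 3)) k⟫) 1 volume := fun j k =>
    memLp_heatKernelTensor hτ le_rfl j k
  have hN : ∀ i, MemLp (oseenHeat τ (fun j k y =>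
      ⟪heatKernel τ (y - x₀) • v, stdOrthonormalBasis ℝ (EuclideanSpace ℝ (Fin 3)) j⟫ *
        ⟪e, stdOrthonormalBasis ℝ (EuclideanSpace ℝ (Fin 3)) k⟫) i) 1 volume := fun i =>
    memLp_oseenHeat finrank_E3 (p := 1) (q := 1) le_rfl le_rfl hF1 hτ i
  calc ∫⁻ x, ‖∑ i, oseenHeat τ (fun j k y =>
        ⟪heatKernel τ (y - x₀) • v, stdOrthonormalBasis ℝ (EuclideanSpace ℝ (Fin 3)) j⟫ *
          ⟪e, stdOrthonormalBasis ℝ (EuclideanSpace ℝ (Fin 3)) k⟫) i x •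
            stdOrthonormalBasis ℝ (EuclideanSpace ℝ (Fin 3)) i‖ₑ
      ≤ ∫⁻ x, ∑ i, ‖oseenHeat τ (fun j k y =>
        ⟪heatKernel τ (y - x₀) • v, stdOrthonormalBasis ℝ (EuclideanSpace ℝ (Fin 3)) j⟫ *
          ⟪e, stdOrthonormalBasis ℝ (EuclideanSpace ℝ (Fin 3)) k⟫) i x‖ₑ :=
        lintegral_mono fun x => (enorm_sum_le _ _).trans (le_of_eq (Finset.sum_congr rfl
          fun i _ => by rw [enorm_smul, enorm_stdOrthonormalBasis, mul_one]))
    _ = ∑ i, ∫⁻ x, ‖oseenHeat τ (fun j k y =>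
        ⟪heatKernel τ (y - x₀) • v, stdOrthonormalBasis ℝ (EuclideanSpace ℝ (Fin 3)) j⟫ *
          ⟪e, stdOrthonormalBasis ℝ (EuclideanSpace ℝ (Fin 3)) k⟫) i x‖ₑ :=
        lintegral_finsetSum' _ fun i _ => (hN i).1.enorm
    _ ≤ ∑ _i : Fin (Module.finrank ℝ (EuclideanSpace ℝ (Fin 3))),
          ENNReal.ofReal (435 * τ ^ (-(1 / 2 : ℝ))) * (9 * (‖v‖ₑ * ‖e‖ₑ)) :=
        Finset.sum_le_sum fun i _ =>
          (lintegral_enorm_oseenHeat_le_of_one finrank_E3 hF1 hτ i).trans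
            (by gcongr; exact sum_eLpNorm_one_heatKernelTensor_le hτ)
    _ = ENNReal.ofReal (11745 * τ ^ (-(1 / 2 : ℝ))) * (‖v‖ₑ * ‖e‖ₑ) := by
        rw [Finset.sum_const, Finset.card_univ, Fintype.card_fin, finrank_E3,
          nsmul_eq_mul, ENNReal.ofReal_mul (by norm_num : (0:ℝ) ≤ 435),
          ENNReal.ofReal_mul (by norm_num : (0:ℝ) ≤ 11745)]
        simp only [ENNReal.ofReal_ofNat]
        push_cast
        ring

/-- **`L¹` bound for the directional derivative of the Oseen kernel**:
`∫ ‖∂ᵥ P(G_σ(·−x₀)e)‖ dx ≤ 23490 σ^{-1/2} ‖v‖ ‖e‖` for `σ > 0`.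
[cite: LemarieRieusset2016, §4.5 Def. 4.2 and Cor. 4.2 (|∂ₓ^α O_{j,k}(x)| ≤ C_α(1+|x|)^{-3-|α|}, |α| = 1, with O_{j,k}(t,x) = t^{-3/2}O_{j,k}(x/√t))] -/
theorem lintegral_enorm_fderiv_lerayHeatTest_apply_le (hσ : 0 < σ) (x₀ e v : EuclideanSpace ℝ (Fin 3)) :
    ∫⁻ x, ‖fderiv ℝ (lerayHeatTest x₀ σ e) x v‖ₑ ≤
      ENNReal.ofReal (23490 * σ ^ (-(1 / 2 : ℝ))) * (‖v‖ₑ * ‖e‖ₑ) := by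
  have h := lintegral_enorm_fderiv_lerayHeatTest_apply_le_of_add_self (half_pos hσ) x₀ e v
  rw [add_halves] at h
  refine h.trans ?_
  gcongr ENNReal.ofReal ?_ * _
  have h2 : (2 : ℝ) ^ (1 / 2 : ℝ) ≤ 2 := by
    calc (2 : ℝ) ^ (1 / 2 : ℝ) ≤ (2 : ℝ) ^ (1 : ℝ) :=
          Real.rpow_le_rpow_of_exponent_le one_le_two (by norm_num)
      _ = 2 := Real.rpow_one 2
  have hsplit : (σ / 2) ^ (-(1 / 2 : ℝ)) = (2 : ℝ) ^ (1 / 2 : ℝ) * σ ^ (-(1 / 2 : ℝ)) := by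
    rw [Real.div_rpow hσ.le zero_le_two, Real.rpow_neg zero_le_two, div_eq_mul_inv, inv_inv,
      mul_comm]
  have hpos : 0 ≤ σ ^ (-(1 / 2 : ℝ)) := Real.rpow_nonneg hσ.le _
  rw [hsplit]
  nlinarith [mul_le_mul_of_nonneg_right h2 hpos]

/-- **`L¹` bound for the full gradient of the Oseen kernel** (operator norm):
`∫ ‖D P(G_σ(·−x₀)e)‖ dx ≤ 70470 σ^{-1/2} ‖e‖` for `σ > 0` — `‖∇ O(t, ·)‖_{L¹} ≤ C t^{-1/2}`.
[cite: LemarieRieusset2016, §4.5 Def. 4.2 and Cor. 4.2 (|∂ₓ^α O_{j,k}(x)| ≤ C_α(1+|x|)^{-3-|α|}, |α| = 1, with O_{j,k}(t,x) = t^{-3/2}O_{j,k}(x/√t))] -/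
theorem lintegral_enorm_fderiv_lerayHeatTest_le (hσ : 0 < σ) (x₀ e : EuclideanSpace ℝ (Fin 3)) :
    ∫⁻ x, ‖fderiv ℝ (lerayHeatTest x₀ σ e) x‖ₑ ≤ ENNReal.ofReal (70470 * σ ^ (-(1 / 2 : ℝ))) * ‖e‖ₑ := by
  have hcont : Continuous (fderiv ℝ (lerayHeatTest x₀ σ e)) :=
    (contDiff_lerayHeatTest hσ).continuous_fderiv (by simp)
  have hpt : ∀ x, ‖fderiv ℝ (lerayHeatTest x₀ σ e) x‖ₑ ≤
      ∑ i, ‖fderiv ℝ (lerayHeatTest x₀ σ e) x (stdOrthonormalBasis ℝ (EuclideanSpace ℝ (Fin 3)) i)‖ₑ :=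
    fun x => by
    rw [← ofReal_norm]
    refine (ENNReal.ofReal_le_ofReal (opNorm_le_sum_norm_apply_orthonormalBasis
      (stdOrthonormalBasis ℝ (EuclideanSpace ℝ (Fin 3))) _)).trans ?_
    rw [ENNReal.ofReal_sum_of_nonneg fun i _ => norm_nonneg _]
    exact le_of_eq (Finset.sum_congr rfl fun i _ => ofReal_norm _)
  calc ∫⁻ x, ‖fderiv ℝ (lerayHeatTest x₀ σ e) x‖ₑ
      ≤ ∫⁻ x, ∑ i, ‖fderiv ℝ (lerayHeatTest x₀ σ e) x
          (stdOrthonormalBasis ℝ (EuclideanSpace ℝ (Fin 3)) i)‖ₑ := lintegral_mono hpt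
    _ = ∑ i, ∫⁻ x, ‖fderiv ℝ (lerayHeatTest x₀ σ e) x
          (stdOrthonormalBasis ℝ (EuclideanSpace ℝ (Fin 3)) i)‖ₑ :=
        lintegral_finsetSum' _ fun i _ => (hcont.clm_apply continuous_const).aemeasurable.enorm
    _ ≤ ∑ i, ENNReal.ofReal (23490 * σ ^ (-(1 / 2 : ℝ))) *
          (‖stdOrthonormalBasis ℝ (EuclideanSpace ℝ (Fin 3)) i‖ₑ * ‖e‖ₑ) :=
        Finset.sum_le_sum fun i _ => lintegral_enorm_fderiv_lerayHeatTest_apply_le hσ x₀ e _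
    _ = ∑ _i : Fin (Module.finrank ℝ (EuclideanSpace ℝ (Fin 3))),
          ENNReal.ofReal (23490 * σ ^ (-(1 / 2 : ℝ))) * ‖e‖ₑ :=
        Finset.sum_congr rfl fun i _ => by rw [enorm_stdOrthonormalBasis, one_mul]
    _ = ENNReal.ofReal (70470 * σ ^ (-(1 / 2 : ℝ))) * ‖e‖ₑ := by
        rw [Finset.sum_const, Finset.card_univ, Fintype.card_fin, finrank_E3,
          nsmul_eq_mul, ENNReal.ofReal_mul (by norm_num : (0:ℝ) ≤ 23490),
          ENNReal.ofReal_mul (by norm_num : (0:ℝ) ≤ 70470)]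
        simp only [ENNReal.ofReal_ofNat]
        push_cast
        ring

end L1

/-! ## The convective pairing bound -/

section Convect

/-- **Convective pairing against the Oseen kernel.** For ANY field `a : ℝ³ → ℝ³` with `‖a‖ ≤ M`
pointwise and `σ > 0`,
`‖∫ ⟪a, (a·∇) P(G_σ(·−x₀)e)⟫‖ ≤ 70470 σ^{-1/2} M² ‖e‖` (`|⟪a, Dψ a⟫| ≤ M² ‖Dψ‖` pointwise and
the `L¹` bound of `∇ψ`; if the pairing is not integrable the Bochner integral is `0`). This is the
linear estimate of the nonlinear Duhamel term in Leray's short-time bound (Tao 2013, proof of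
Prop. 9.1, (9.2), in tested form). [cite: LemarieRieusset2016, §4.5 Cor. 4.2] [cite: Tao2011, Prop. 9.1 (proof, (9.2))] -/
theorem enorm_integral_inner_convect_lerayHeatTest_le_of_bound {σ : ℝ} (hσ : 0 < σ)
    (x₀ e : EuclideanSpace ℝ (Fin 3)) {a : EuclideanSpace ℝ (Fin 3) → EuclideanSpace ℝ (Fin 3)} {M : ℝ}
    (ha : ∀ x, ‖a x‖ ≤ M) :
    ‖∫ x, ⟪a x, convect a (lerayHeatTest x₀ σ e) x⟫‖ₑ ≤
      ENNReal.ofReal (70470 * σ ^ (-(1 / 2 : ℝ))) * ENNReal.ofReal (M ^ 2) * ‖e‖ₑ := by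
  calc ‖∫ x, ⟪a x, convect a (lerayHeatTest x₀ σ e) x⟫‖ₑ
      ≤ ∫⁻ x, ‖⟪a x, convect a (lerayHeatTest x₀ σ e) x⟫‖ₑ := enorm_integral_le_lintegral_enorm _
    _ ≤ ∫⁻ x, ENNReal.ofReal (M ^ 2) * ‖fderiv ℝ (lerayHeatTest x₀ σ e) x‖ₑ :=
        lintegral_mono fun x => by
          rw [convect_apply, ← ofReal_norm, ← ofReal_norm, ← ENNReal.ofReal_mul (sq_nonneg M)]
          exact ENNReal.ofReal_le_ofReal (norm_inner_apply_self_le (ha x) _)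
    _ = ENNReal.ofReal (M ^ 2) * ∫⁻ x, ‖fderiv ℝ (lerayHeatTest x₀ σ e) x‖ₑ :=
        lintegral_const_mul' _ _ ENNReal.ofReal_ne_top
    _ ≤ ENNReal.ofReal (M ^ 2) * (ENNReal.ofReal (70470 * σ ^ (-(1 / 2 : ℝ))) * ‖e‖ₑ) := by
        gcongr
        exact lintegral_enorm_fderiv_lerayHeatTest_le hσ x₀ e
    _ = ENNReal.ofReal (70470 * σ ^ (-(1 / 2 : ℝ))) * ENNReal.ofReal (M ^ 2) * ‖e‖ₑ := by ring

/-- The same bound at the clock `ε + s`, with the rate in `s` alone (`(ε+s)^{-1/2} ≤ s^{-1/2}`),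
uniformly in the regularisation `ε > 0`. [cite: LemarieRieusset2016, §4.5 Cor. 4.2] [cite: Tao2011, Prop. 9.1 (proof, (9.2))] -/
theorem enorm_integral_inner_convect_lerayHeatTest_le_of_bound_add {ε s : ℝ} (hε : 0 < ε) (hs : 0 < s)
    (x₀ e : EuclideanSpace ℝ (Fin 3)) {a : EuclideanSpace ℝ (Fin 3) → EuclideanSpace ℝ (Fin 3)} {M : ℝ}
    (ha : ∀ x, ‖a x‖ ≤ M) :
    ‖∫ x, ⟪a x, convect a (lerayHeatTest x₀ (ε + s) e) x⟫‖ₑ ≤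
      (70470 : ℝ≥0) * ENNReal.ofReal (s ^ (-(1 / 2 : ℝ))) * ENNReal.ofReal (M ^ 2) * ‖e‖ₑ := by
  refine (enorm_integral_inner_convect_lerayHeatTest_le_of_bound (add_pos hε hs) x₀ e ha).trans ?_
  have hrate : (ε + s) ^ (-(1 / 2 : ℝ)) ≤ s ^ (-(1 / 2 : ℝ)) :=
    Real.rpow_le_rpow_of_nonpos hs (le_add_of_nonneg_left hε.le) (by norm_num)
  have hc : ENNReal.ofReal (70470 * (ε + s) ^ (-(1 / 2 : ℝ))) ≤
      (70470 : ℝ≥0) * ENNReal.ofReal (s ^ (-(1 / 2 : ℝ))) := by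
    rw [ENNReal.ofReal_mul (by norm_num : (0:ℝ) ≤ 70470)]
    simp only [ENNReal.ofReal_ofNat, ENNReal.coe_ofNat]
    gcongr
  gcongr

/-- **Packaged form** (one universal constant): there is `C₁` such that for all `x₀, e`, all
`ε, s > 0`, every square-integrable continuous field `a` with `‖a‖ ≤ M` pointwise,
`‖∫ ⟪a, (a·∇) P(G_{ε+s}(·−x₀)e)⟫‖ ≤ C₁ s^{-1/2} M² ‖e‖`. (The integrability and continuity
hypotheses are not used; they are carried so that the statement is literally the convective-pairing
hypothesis of the forced Leray short-time bound.) [cite: LemarieRieusset2016, §4.5 Cor. 4.2] [cite: Tao2011, Prop. 9.1 (proof, (9.2))] -/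
theorem exists_convect_lerayHeatTest_bound :
    ∃ C₁ : ℝ≥0, ∀ (x₀ e : EuclideanSpace ℝ (Fin 3)) {ε s : ℝ}, 0 < ε → 0 < s →
      ∀ {a : EuclideanSpace ℝ (Fin 3) → EuclideanSpace ℝ (Fin 3)}, MemLp a 2 volume → Continuous a →
        ∀ {M : ℝ}, (∀ x, ‖a x‖ ≤ M) →
          ‖∫ x, ⟪a x, convect a (lerayHeatTest x₀ (ε + s) e) x⟫‖ₑ ≤
            C₁ * ENNReal.ofReal (s ^ (-(1 / 2 : ℝ))) * ENNReal.ofReal (M ^ 2) * ‖e‖ₑ :=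
  ⟨70470, fun x₀ e _ _ hε hs _ _ _ _ ha =>
    enorm_integral_inner_convect_lerayHeatTest_le_of_bound_add hε hs x₀ e ha⟩

end Convect

end Literature.Analysis.FluidPDE
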